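import Literature.Computability.AlgebraicComplexity.KV20Cor13OfSuccinctCircuit
import Literature.Computability.AlgebraicComplexity.KV20KernelCircuitOutputs
import Literature.Computability.Complexity.SuccinctCircuitBitsSplitExt
import HarnessLib

/-!
# Kumar–Volk Cor. 1.3 from a succinct circuit holding the kernel-vector entries as SPLIT gates
# (val-lit KV20 M1 programme: the split-gate wrapper of RULING (129))

`KV20Cor13OfSuccinctCircuit.lean` derives `kumarVolk2020_cor_1_3` from any succinct circuit holding
two's-complement representatives of the kernel-vector entries `kvKernelEntry n c` and of their
negatives. The kernel-vector circuit of the programme (`SuccinctKernelVectorCircuit.lean`, x5 g7)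
holds each entry as a PAIR of natural gates `V⁺, V⁻` with `V⁺ − V⁻ =` the entry. The split-gate
extension `SuccCircuit.splitExt` (`SuccinctCircuitBitsSplitExt.lean`) adjoins, to any circuit,
the gates `X⁺ = V⁺ + (2^{v+1} − 1)·V⁻ ≡ V⁺ − V⁻` and `X⁻ ≡ V⁻ − V⁺`; composing:

* **`kumarVolk2020_cor_1_3_of_splitCircuit`** — if a succinct circuit `K` has gates `vp n c`,
  `vn n c`, polynomial-time in `⟨1ⁿ, c⟩`, with `K.val (vp n c) − K.val (vn n c) = kvKernelEntry n c`
  and both values `< 2^{v(n)}` (`v` polynomial-time on `1ⁿ`) for `1 ≤ n`, `c < (n³+1)^{n²}`, then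
  `kumarVolk2020_cor_1_3`.
* ★★★ **`kumarVolk2020_cor_1_3_holds : kumarVolk2020_cor_1_3`** — the instantiation `K := kvc
  kvMatrixFamily` (the succinct kernel-vector circuit of the Kumar–Volk evaluation system, x5 g7
  `SuccinctKernelVectorGates/Circuit/Values` + `KV20KernelCircuitOutputs`, t21 g11/g12
  `KV20EvaluationMatrixFP` / `KV20CoefficientQueryFP` / `KV20SuccinctMatrixData`), `vp/vn :=
  outName _ n 0/1 c`, `v := Wmux`: the last line of the val-lit KV20 M1 programme (lead-np RULINGS
  (120), (129), (131); x5 g7's one-liner, appended here verbatim by ruling). It DISCHARGES the named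
  fact `kumarVolk2020_cor_1_3` (`KV20EquationsPITWinWin.lean`).

HONEST FRAMING (val-lit, KV20 M1 programme): Kumar–Volk Cor. 1.3 is a published CONDITIONAL
(win–win) CONSEQUENCE statement ("if PIT ∈ P then … (1) or (2)"); its proof here is bookkeeping
of the published small-space linear algebra; `VP ≠ VNP` is NOT proved and nothing in this file
bears on it; rung V4 is untouched.

## References

* M. Kumar, B. L. Volk, *A polynomial degree bound on equations for non-rigid matrices and small
  linear circuits*, ACM TOCT 14 (2022), Cor. 1.3 and §6 [KumarVolk2022].
* D. E. Knuth, *TAOCP 2*, §4.1 (two's complement) [KnuthTAOCP2].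
* P. Koiran, S. Perifel, *VPSPACE and a transfer theorem over the reals*, Comput. Complexity 18
  (2009), §3.2 Prop. 1 [KoiranPerifel2009VPSPACE].
-/

noncomputable section

namespace Literature.Computability.AlgebraicComplexity

namespace KumarVolk2020

namespace UEval

open Literature.Computability.Complexity Literature.Computability.Complexity.CodeFP Brick
  Literature.Computability.Complexity.SuccCircuit

/-- ★ **Kumar–Volk Cor. 1.3 from split gates.** Let `K` be a succinct circuit with gates `vp n c`,
`vn n c` (polynomial-time in `⟨1ⁿ, c⟩`) such that, for `1 ≤ n` and `c < (n³+1)^{n²}`,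
`val (vp n c) − val (vn n c) = kvKernelEntry n c` and both values are `< 2^{v(n)}` with `v`
polynomial-time on `1ⁿ`. Then `kumarVolk2020_cor_1_3` — through the split-gate extension
`K.splitExt` (gates `X± ≡ ±(V⁺ − V⁻) (mod 2^{v+1})`) and `kumarVolk2020_cor_1_3_of_succinctCircuit`.
[cite: KumarVolk2022, Cor. 1.3 (proof, §6: "small-space linear algebra")] [cite: KnuthTAOCP2, §4.1] -/
theorem kumarVolk2020_cor_1_3_of_splitCircuit (K : SuccCircuit)
    {vp vn : ℕ → ℕ → List Bool} {v : ℕ → ℕ}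
    (hvp : CodeFP (pairE unE natE) strE (fun p => vp p.1 p.2))
    (hvn : CodeFP (pairE unE natE) strE (fun p => vn p.1 p.2))
    (hv : CodeFP unE natE v)
    (hlt : ∀ n c, 1 ≤ n → c < (n ^ 3 + 1) ^ (n * n) → K.val (vp n c) < 2 ^ v n ∧ K.val (vn n c) < 2 ^ v n)
    (hsub : ∀ n c, 1 ≤ n → c < (n ^ 3 + 1) ^ (n * n) →
      (K.val (vp n c) : ℤ) - K.val (vn n c) = kvKernelEntry n c) :
    kumarVolk2020_cor_1_3 := by
  -- the payloads `⟨bin (v n), ⟨vp n c, vn n c⟩⟩` and the adjoined gates, in polynomial time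
  have harg : CodeFP (pairE unE natE) (pairE natE (pairE strE strE)) (fun p => (v p.1, (vp p.1 p.2, vn p.1 p.2))) :=
    (hv.comp (fst unE natE)).pair (hvp.pair hvn)
  have hpay : CodeFP (pairE unE natE) strE (fun p => splitPayload (v p.1) (vp p.1 p.2) (vn p.1 p.2)) :=
    (splitPayload_fp.comp harg).congr fun _ => rfl
  have hpos : CodeFP (pairE unE natE) strE (fun p => xposName (splitPayload (v p.1) (vp p.1 p.2) (vn p.1 p.2))) :=
    (xposName_fp.comp hpay).congr fun _ => rfl
  have hneg : CodeFP (pairE unE natE) strE (fun p => xnegName (splitPayload (v p.1) (vp p.1 p.2) (vn p.1 p.2))) :=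
    (xnegName_fp.comp hpay).congr fun _ => rfl
  refine kumarVolk2020_cor_1_3_of_succinctCircuit K.splitExt
    (pos := fun n c => xposName (splitPayload (v n) (vp n c) (vn n c)))
    (neg := fun n c => xnegName (splitPayload (v n) (vp n c) (vn n c))) (v := v) (z := zeroName)
    hpos hneg hv K.val_splitExt_zero (fun n c hn hc => ?_) (fun n c hn hc => ?_) (fun n c hn hc => ?_)
  · -- the height bound: `|V⁺ − V⁻| < 2^v`
    obtain ⟨h1, h2⟩ := hlt n c hn hc
    have h := hsub n c hn hc
    have hp : ((K.val (vp n c) : ℕ) : ℤ) < 2 ^ v n := by exact_mod_cast h1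
    have hq : ((K.val (vn n c) : ℕ) : ℤ) < 2 ^ v n := by exact_mod_cast h2
    have h0p : (0 : ℤ) ≤ K.val (vp n c) := by positivity
    have h0q : (0 : ℤ) ≤ K.val (vn n c) := by positivity
    have habs : ((kvKernelEntry n c).natAbs : ℤ) < 2 ^ v n := by
      rw [Int.natCast_natAbs, ← h]
      rcases le_or_gt 0 ((K.val (vp n c) : ℤ) - K.val (vn n c)) with hle | hgt
      · rw [abs_of_nonneg hle]; linarith
      · rw [abs_of_neg hgt]; linarith
    exact_mod_cast habs
  · -- `X⁺` represents the entry
    rw [← hsub n c hn hc]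
    exact K.xpos_rep (v n) (vp n c) (vn n c)
  · -- `X⁻` represents its negative
    rw [← hsub n c hn hc]
    exact K.xneg_rep (v n) (vp n c) (vn n c)

end UEval

end KumarVolk2020

open Literature.Computability.Complexity.KVC in
/-- ★★★ **Kumar–Volk, Cor. 1.3 holds**: "Suppose `PIT ∈ P`. Then at least one of the following is
true: (1) there is a family of polynomials of polynomially bounded degree, computed as its list of
coefficients in `PSPACE`, without polynomial-size constant-free circuits; (2) there is a family of
matrices, constructible in polynomial time with an `NP` oracle, requiring linear circuits of size
`Ω(n²)`" (as typed in `KV20EquationsPITWinWin.lean`) — discharged through x5 g6's reduction to the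
canonical equation (`…_of_canonicalBits`), t21's coefficient-query read-out, the succinct
kernel-vector circuit `kvc kvMatrixFamily` (x5 g7), the split-gate two's-complement wrapper and the
certified polynomial-space evaluator of succinct circuits (p1 g8/g9). [cite: KumarVolk2022, Cor. 1.3 (proof, §6: "a fixed PSPACE algorithm … standard small-space linear algebra")] -/
theorem kumarVolk2020_cor_1_3_holds : kumarVolk2020_cor_1_3 :=
  KumarVolk2020.UEval.kumarVolk2020_cor_1_3_of_splitCircuit (kvc KumarVolk2020.kvMatrixFamily)
    (vp := fun n c => outName KumarVolk2020.kvMatrixFamily n 0 c)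
    (vn := fun n c => outName KumarVolk2020.kvMatrixFamily n 1 c) (v := KumarVolk2020.kvMatrixFamily.Wmux)
    (codeFP_outName₀ KumarVolk2020.kvMatrixFamily) (codeFP_outName₁ KumarVolk2020.kvMatrixFamily)
    (Wmux_fp KumarVolk2020.kvMatrixFamily) KumarVolk2020.kvc_val_lt KumarVolk2020.kvc_val_sub_kernelEntry

end Literature.Computability.AlgebraicComplexity
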